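import Summits.QuantumFields.YangMills.Theorems.FluctuationComparisonRegPrIntLS2BetaResidualGauge
import HarnessLib

/-!
# REGISTRY STUB 2 «GAP♯∘» `UniformFibreGapOrbit` — THE TWO-MECHANISM DOOR: GAP♯∘ ⟸ {TUBE∘, CLOSE∘}, and TUBE∘ ⟸ GAP♯∘
# (crux `FluctuationComparisonRegPrIntL`, stmt-QuantumFields-20520; registry of record v11.4 `Cruxes/FluctuationComparisonRegPrIntL/Lines/semiclassical_s2beta.lean`
# sha16 3732b7dff0e7789b, FROZEN (★★OWNER RULING №36) — `def UniformFibreGapOrbit` l.768, `stub_uniformFibreGapOrbit` l.1387; nothing of it is edited here)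

Cell `ym3-torus` (YM ladder rung R3 = continuum `SU(2)` Yang–Mills on the three-torus — a RUNG: NOT d = 4, NOT infinite volume, NOT a mass gap, NOT Clay).
Seat `ymfull-r3-prover-3` (gen 0; R590-ym (a) item (3)); `--kind proof --supports stmt-QuantumFields-20520 --as helper`, count-neutral, DEFINITION-FREE
(0 `def`, 0 `instance`, 0 `notation`, 0 `sorry`, default heartbeats).

WHAT GAP♯∘ SAYS (v11.4 text, by-text docking — Cruxes workfiles cannot be imported; the two RG-K substitutions of ✓`…S2BetaResidualGaugeOrbit` ∕
✓p770212 `…WindowExactnessOfGapOrbitThm1`: `argminHist` ↦ its set-builder body, `ResidualGauge F hJK` ↦ `{w | ∀ U, descendTo … (gaugeAct w U) = descendTo … U}`):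
under the shared ∘-prefix `∀ L, ∃ c₀ ∈ (0,1], ∀ cw ∈ (0,c₀], ∃ pS, ∀ b₀ p₀, ∃ ε₁, ∀ ε₀ ∈ (0,ε₁], ∃ γ₁, ∃ μ > 0, ∀ F γ, ∀ J ≤ K, ∀ V` in the INTERIOR window
`PlaqSmall (θBal F.L γ (cw·b₀) p₀ J) V`, for every action-minimising good history `U₀` over `V` and every good history `U` over `V`:
`μ·L^{−2(K−J)} · ⨅_{w residual} Σ_ℓ dist1(U ℓ·((w•U₀) ℓ)⁻¹)² ≤ wilsonAction4 U − minActionRegPr F J K hJK ε₀ V`.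

WHY THIS FILE.  In print the inequality is never met head-on on the whole small-field fibre: the `k`-th renormalization step FIRST puts every configuration of
the small-field region of integration into a uniform sup-tube about the background — [Balaban1985UV3] p.259 (the sentence after (12)): «`U₁`, `U′U₁` satisfy the
assumptions of Lemma 1 [6] with `α₀ = 2L²B₃g₀p(g₀)`, `α₁ = 0`, and the lemma yields the bound `|U′ − 1| < 8·32L²B₃g₀p(g₀)`» ([6] = [Balaban1985RegularSpaces] Lemma 1
(1.24)–(1.26) pp.79–80: two configurations with small plaquette variables and the same (or `α₁`-close) averages are close in the axial gauge) — and THEN expands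
the action in the fluctuation field inside that tube, where the quadratic form is the positive operator of [Balaban1985Variational] (26)∕(142) and
[Balaban1984PropagatorsII] (1.33) and the higher orders are controlled by the tube radius ([Balaban1985UV3] (18)–(22), (27)–(28)).  The registered row GAP♯∘
is therefore the conjunction of two rows with DIFFERENT mechanisms and different natural suppliers, displayed here as binder-free hypotheses in the registry's
own letters (no `def`, no new object):

* **TUBE∘** («quadratic growth in a uniform sup-tube», the perturbative row; L–XL): GAP♯∘'s text VERBATIM with ONE more existential `∃ δ > 0` (after `ε₀`, before `γ₁`;
  `δ` may depend on `L, cw, b₀, p₀, ε₀`) and ONE more hypothesis on `U` — «`U` lies in the sup-tube of radius `δ` about the residual orbit of `U₀`»: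
  `∃ w residual, ∀ ℓ, dist1(U ℓ·((w•U₀) ℓ)⁻¹) ≤ δ`.  Print: [Balaban1985Variational] (142) p.299 (positivity of the Hessian on the slice transversal to the orbit),
  [Balaban1984PropagatorsII] (1.33) (its `K`-free lower bound), [Balaban1985UV3] (18)–(22) p.260 (the expansion in the tube).
* **CLOSE∘** («good histories over one interior datum are residual-gauge sup-close to any minimising one», the kinematic small-field row; M–L): the same
  ∘-prefix up to `ε₀`, then `∀ δ > 0, ∃ γ₁ > 0` and, for the same `V, U₀, U`, the tube membership above.  Print: [Balaban1985RegularSpaces] Lemma 1 (1.24)–(1.26)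
  pp.79–80 at every height of the history (one step = [Balaban1985UV3] p.259), summed along the decreasing thresholds `θBal(K−j)` (tree: ✓`T3Thresholds.θBal_succ_le`,
  ✓`T3SmallLiftHistory.sqrt_inv_mul_θBal_le_succ`); the interior-bond half of one step is the tree's ✓`Prop7AxialGaugeBlock.dist1_mul_inv_le_interior`, the
  inter-block half («(1.25) on the bonds joining two blocks, from the averaging constraint») is that file's recorded TODO.
  Its binder-light PAIR FORM **CLOSE-PAIR∘** (any two good histories over one datum, no window, no `cw ∕ pS ∕ ε₀`) implies CLOSE∘ (`close_of_closePair`, §1).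

WHAT IS PROVED (pure quantifier bookkeeping over the registry's letters; thresholds merge by `min`∕`max` exactly as in ✓p770212):
* §1 ★ `close_of_closePair` — CLOSE-PAIR∘ → CLOSE∘ (a minimising good history is a good history: `argminHist ⊆ fibre ∩ histGood`).
* §2 ★ `tube_of_uniformFibreGapOrbit` — GAP♯∘ → TUBE∘ (take `δ := 1` and forget the tube: TUBE∘ is GAP♯∘ RESTRICTED, no strength is added on the tube).
* §3 ★★★ `uniformFibreGapOrbit_of_tube_of_close (hT : ⟨TUBE∘⟩) (hC : ⟨CLOSE∘⟩) : ⟨GAP♯∘ TEXT VERBATIM⟩` — docks in `Lines/semiclassical_s2beta.lean` by `exact` (the conclusion is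
  ✓p770212's `hGap` token for token); ★★ `uniformFibreGapOrbit_of_tube_of_closePair` — the same from TUBE∘ and CLOSE-PAIR∘.

NET (registry granularity, CREDIT NOTHING): GAP♯∘ ⟺ TUBE∘ given CLOSE∘; so «GAP♯∘ modulo letters {TUBE∘, CLOSE∘}», each letter with its print locus and its tree road.
CLOSE∘ is slightly MORE than GAP♯∘ needs (sup-closeness, where GAP♯∘ only returns `ℓ²`-closeness): that is the honest price of following print, whose region of
integration lives inside the tube ([Balaban1985UV3] p.259 «We enlarge the region of integration to all configurations `V′ = e^{iA′}` satisfying `|A′| < 16·32L²B₃g₀p(g₀)`»).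
HONEST: a door; TUBE∘, CLOSE∘, CLOSE-PAIR∘, GAP♯∘, EXW∘, S2β `FluctuationPartSmall`, `FluctuationComparisonRegPrIntL` (20520) are NOT proved here; no summit statement is
proved by a helper; finite-volume ∕ conditional throughout; rung R3 = SU(2) YM₃ on T³ — NOT d = 4, NOT infinite volume, NOT a mass gap, NOT Clay; the Yang–Mills mass
gap is NOT proved.  Sorry-free, axioms standard.

References: T. Bałaban, CMP **102** (1985) 277–309 [Balaban1985Variational] ((26) p.283, Thm 1 (8)–(10) p.279, (142) p.299); CMP **99** (1985) 75–102
[Balaban1985RegularSpaces] (Lemma 1 (1.24)–(1.26) pp.79–80); CMP **96** (1984) 223–250 [Balaban1984PropagatorsII] ((1.33)); CMP **102** (1985) 255–275 [Balaban1985UV3]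
((12)–(13) p.258–259, (18)–(22) p.260, (27)–(28) p.263).
-/

set_option autoImplicit false

noncomputable section

open MeasureTheory Filter Topology Set
open scoped Matrix.Norms.L2Operator
open Literature.MathematicalPhysics.QuantumFieldTheory.Balaban1983to89
open Literature.MathematicalPhysics.QuantumFieldTheory.Balaban1983to89.T3ContinuumYM3Torus
open Literature.MathematicalPhysics.QuantumFieldTheory.Balaban1983to89.T3UnitLawDensityEML
open Literature.MathematicalPhysics.QuantumFieldTheory.Balaban1983to89.T3UnitScaleTilt
open Literature.MathematicalPhysics.QuantumFieldTheory.Balaban1983to89.T3TiltDescent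
open Literature.MathematicalPhysics.QuantumFieldTheory.Balaban1983to89.T3PrintedRegularMinimiser
open Literature.MathematicalPhysics.QuantumFieldTheory.Balaban1983to89.T3ConstrainedMinimiser (fibre)
open Literature.MathematicalPhysics.QuantumFieldTheory.Balaban1983to89.Missing
open Literature.MathematicalPhysics.QuantumFieldTheory.Balaban1983to89.T4Continuum

namespace Summit.QuantumFields.YangMills.Theorems.FluctuationComparisonRegPrIntLS2BetaGapOrbitOfTubeClose

/-! ## §1 CLOSE-PAIR∘ → CLOSE∘ -/

/-- ★ **CLOSE-PAIR∘ → CLOSE∘**: if, below a coupling threshold depending on `L, b₀, p₀, δ`, ANY two good histories over one datum are residual-gauge `δ`-close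
in sup (pair form: no window, no `cw ∕ pS ∕ ε₀`), then in particular every good history is `δ`-close to the residual orbit of every action-minimising good
history over every interior-window datum (the guarded form CLOSE∘ read by §3; `c₀ := 1`, `pS := 0`, `ε₁ := 1` serve vacuously).
[cite: Balaban1985RegularSpaces, Lemma 1 (1.24)-(1.26) pp.79-80; Balaban1985UV3, (12)-(13) p.259] -/
theorem close_of_closePair
    (hP : ∀ (L : ℕ) (b₀ p₀ : ℝ), 0 < b₀ → 0 < p₀ → ∀ (δ : ℝ), 0 < δ →
      ∃ γ₁ : ℝ, 0 < γ₁ ∧ ∀ (F : T3Family) (γ : ℝ), F.L = L → 0 < γ → γ ≤ γ₁ →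
        ∀ (J K : ℕ) (hJK : J ≤ K) (V : GaugeField (F.P J) 0 (Matrix.specialUnitaryGroup (Fin 2) ℂ)),
          ∀ U' ∈ fibre F ℰp J K hJK V, U' ∈ histGood F ℰp (θBal F.L γ b₀ p₀) K J →
            ∀ U ∈ fibre F ℰp J K hJK V, U ∈ histGood F ℰp (θBal F.L γ b₀ p₀) K J →
              ∃ w : Site (F.P K) 0 → Matrix.specialUnitaryGroup (Fin 2) ℂ,
                (∀ U'' : GaugeField (F.P K) 0 (Matrix.specialUnitaryGroup (Fin 2) ℂ),
                    descendTo F ℰp J K hJK (GaugeField.gaugeAct w U'') = descendTo F ℰp J K hJK U'') ∧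
                  ∀ ℓ : PBond (F.P K) 0, dist1 (U ℓ * ((GaugeField.gaugeAct w U') ℓ)⁻¹) ≤ δ) :
    ∀ (L : ℕ), ∃ c₀ : ℝ, 0 < c₀ ∧ c₀ ≤ 1 ∧ ∀ (cw : ℝ), 0 < cw → cw ≤ c₀ → ∃ pS : ℝ, ∀ (b₀ p₀ : ℝ), 0 < b₀ → pS ≤ p₀ → 0 < p₀ →
      ∃ ε₁ : ℝ, 0 < ε₁ ∧ ∀ (ε₀ : ℝ), 0 < ε₀ → ε₀ ≤ ε₁ → ∀ (δ : ℝ), 0 < δ →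
      ∃ γ₁ : ℝ, 0 < γ₁ ∧ ∀ (F : T3Family) (γ : ℝ), F.L = L → 0 < γ → γ ≤ γ₁ →
        ∀ (J K : ℕ) (hJK : J ≤ K) (V : GaugeField (F.P J) 0 (Matrix.specialUnitaryGroup (Fin 2) ℂ)), PlaqSmall (θBal F.L γ (cw * b₀) p₀ J) V →
          ∀ U₀ ∈ {U' | U' ∈ fibre F ℰp J K hJK V ∧ U' ∈ histGood F ℰp (θBal F.L γ b₀ p₀) K J ∧
              wilsonAction4 U' = minActionRegPr F J K hJK ε₀ V},
            ∀ U ∈ fibre F ℰp J K hJK V, U ∈ histGood F ℰp (θBal F.L γ b₀ p₀) K J →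
              ∃ w : Site (F.P K) 0 → Matrix.specialUnitaryGroup (Fin 2) ℂ,
                (∀ U'' : GaugeField (F.P K) 0 (Matrix.specialUnitaryGroup (Fin 2) ℂ),
                    descendTo F ℰp J K hJK (GaugeField.gaugeAct w U'') = descendTo F ℰp J K hJK U'') ∧
                  ∀ ℓ : PBond (F.P K) 0, dist1 (U ℓ * ((GaugeField.gaugeAct w U₀) ℓ)⁻¹) ≤ δ := by
  intro L
  refine ⟨1, one_pos, le_rfl, fun cw _ _ => ⟨0, fun b₀ p₀ hb _ hp => ⟨1, one_pos, fun ε₀ _ _ δ hδ => ?_⟩⟩⟩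
  obtain ⟨γ₁, hγ₁, H⟩ := hP L b₀ p₀ hb hp δ hδ
  refine ⟨γ₁, hγ₁, fun F γ hFL hγ hγle J K hJK V _ U₀ hU₀ U hU hUg => ?_⟩
  exact H F γ hFL hγ hγle J K hJK V U₀ hU₀.1 hU₀.2.1 U hU hUg

/-! ## §2 GAP♯∘ → TUBE∘ (the tube row is the registered row restricted) -/

/-- ★ **GAP♯∘ → TUBE∘**: the registered row implies its restriction to any tube (`δ := 1`, the tube hypothesis is discarded) — TUBE∘ adds no strength on
the tube, so the door of §3 loses nothing on the TUBE side. [cite: Balaban1985Variational, (142) p.299; Balaban1984PropagatorsII, (1.33)] -/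
theorem tube_of_uniformFibreGapOrbit
    (hGap : ∀ (L : ℕ), ∃ c₀ : ℝ, 0 < c₀ ∧ c₀ ≤ 1 ∧ ∀ (cw : ℝ), 0 < cw → cw ≤ c₀ → ∃ pS : ℝ, ∀ (b₀ p₀ : ℝ), 0 < b₀ → pS ≤ p₀ → 0 < p₀ →
      ∃ ε₁ : ℝ, 0 < ε₁ ∧ ∀ (ε₀ : ℝ), 0 < ε₀ → ε₀ ≤ ε₁ →
      ∃ γ₁ : ℝ, 0 < γ₁ ∧ ∃ μ : ℝ, 0 < μ ∧ ∀ (F : T3Family) (γ : ℝ), F.L = L → 0 < γ → γ ≤ γ₁ →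
        ∀ (J K : ℕ) (hJK : J ≤ K) (V : GaugeField (F.P J) 0 (Matrix.specialUnitaryGroup (Fin 2) ℂ)), PlaqSmall (θBal F.L γ (cw * b₀) p₀ J) V →
          ∀ U₀ ∈ {U' | U' ∈ fibre F ℰp J K hJK V ∧ U' ∈ histGood F ℰp (θBal F.L γ b₀ p₀) K J ∧
              wilsonAction4 U' = minActionRegPr F J K hJK ε₀ V},
            ∀ U ∈ fibre F ℰp J K hJK V, U ∈ histGood F ℰp (θBal F.L γ b₀ p₀) K J →
              μ * ((F.L : ℝ)⁻¹) ^ (2 * (K - J)) *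
                  (⨅ w : {w : Site (F.P K) 0 → Matrix.specialUnitaryGroup (Fin 2) ℂ |
                      ∀ U : GaugeField (F.P K) 0 (Matrix.specialUnitaryGroup (Fin 2) ℂ),
                        descendTo F ℰp J K hJK (GaugeField.gaugeAct w U) = descendTo F ℰp J K hJK U},
                    ∑ ℓ : PBond (F.P K) 0,
                      dist1 (U ℓ * ((GaugeField.gaugeAct (w : Site (F.P K) 0 → Matrix.specialUnitaryGroup (Fin 2) ℂ) U₀) ℓ)⁻¹) ^ 2)
                ≤ wilsonAction4 U - minActionRegPr F J K hJK ε₀ V) :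
    ∀ (L : ℕ), ∃ c₀ : ℝ, 0 < c₀ ∧ c₀ ≤ 1 ∧ ∀ (cw : ℝ), 0 < cw → cw ≤ c₀ → ∃ pS : ℝ, ∀ (b₀ p₀ : ℝ), 0 < b₀ → pS ≤ p₀ → 0 < p₀ →
      ∃ ε₁ : ℝ, 0 < ε₁ ∧ ∀ (ε₀ : ℝ), 0 < ε₀ → ε₀ ≤ ε₁ → ∃ δ : ℝ, 0 < δ ∧
      ∃ γ₁ : ℝ, 0 < γ₁ ∧ ∃ μ : ℝ, 0 < μ ∧ ∀ (F : T3Family) (γ : ℝ), F.L = L → 0 < γ → γ ≤ γ₁ →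
        ∀ (J K : ℕ) (hJK : J ≤ K) (V : GaugeField (F.P J) 0 (Matrix.specialUnitaryGroup (Fin 2) ℂ)), PlaqSmall (θBal F.L γ (cw * b₀) p₀ J) V →
          ∀ U₀ ∈ {U' | U' ∈ fibre F ℰp J K hJK V ∧ U' ∈ histGood F ℰp (θBal F.L γ b₀ p₀) K J ∧
              wilsonAction4 U' = minActionRegPr F J K hJK ε₀ V},
            ∀ U ∈ fibre F ℰp J K hJK V, U ∈ histGood F ℰp (θBal F.L γ b₀ p₀) K J →
              (∃ w : Site (F.P K) 0 → Matrix.specialUnitaryGroup (Fin 2) ℂ,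
                (∀ U'' : GaugeField (F.P K) 0 (Matrix.specialUnitaryGroup (Fin 2) ℂ),
                    descendTo F ℰp J K hJK (GaugeField.gaugeAct w U'') = descendTo F ℰp J K hJK U'') ∧
                  ∀ ℓ : PBond (F.P K) 0, dist1 (U ℓ * ((GaugeField.gaugeAct w U₀) ℓ)⁻¹) ≤ δ) →
              μ * ((F.L : ℝ)⁻¹) ^ (2 * (K - J)) *
                  (⨅ w : {w : Site (F.P K) 0 → Matrix.specialUnitaryGroup (Fin 2) ℂ |
                      ∀ U : GaugeField (F.P K) 0 (Matrix.specialUnitaryGroup (Fin 2) ℂ),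
                        descendTo F ℰp J K hJK (GaugeField.gaugeAct w U) = descendTo F ℰp J K hJK U},
                    ∑ ℓ : PBond (F.P K) 0,
                      dist1 (U ℓ * ((GaugeField.gaugeAct (w : Site (F.P K) 0 → Matrix.specialUnitaryGroup (Fin 2) ℂ) U₀) ℓ)⁻¹) ^ 2)
                ≤ wilsonAction4 U - minActionRegPr F J K hJK ε₀ V := by
  intro L
  obtain ⟨c₀, hc₀, hc₀1, h⟩ := hGap L
  refine ⟨c₀, hc₀, hc₀1, fun cw hcw hcwle => ?_⟩
  obtain ⟨pS, h'⟩ := h cw hcw hcwle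
  refine ⟨pS, fun b₀ p₀ hb hpS hp => ?_⟩
  obtain ⟨ε₁, hε₁, h''⟩ := h' b₀ p₀ hb hpS hp
  refine ⟨ε₁, hε₁, fun ε₀ hε₀ hε₀le => ?_⟩
  obtain ⟨γ₁, hγ₁, μ, hμ, H⟩ := h'' ε₀ hε₀ hε₀le
  refine ⟨1, one_pos, γ₁, hγ₁, μ, hμ, fun F γ hFL hγ hγle J K hJK V hV U₀ hU₀ U hU hUg _ => ?_⟩
  exact H F γ hFL hγ hγle J K hJK V hV U₀ hU₀ U hU hUg

/-! ## §3 The door: TUBE∘ ∧ CLOSE∘ → GAP♯∘ (registry text verbatim) -/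

/-- ★★★ **THE TWO-MECHANISM DOOR — TUBE∘ ∧ CLOSE∘ ⟹ GAP♯∘** (conclusion = the v11.4 text of `UniformFibreGapOrbit` with the two RG-K substitutions, i.e.
✓p770212's `hGap` token for token; docks in the registry by `exact`).  Thresholds: `c₀ := min`, `pS := max`, `ε₁ := min`; at `ε₀` TUBE∘ yields its tube radius
`δ`, its `γ₁ᵀ` and `μ`; CLOSE∘ at that `δ` yields `γ₁ᶜ`; `γ₁ := min γ₁ᵀ γ₁ᶜ`; at a datum, CLOSE∘ puts the good history `U` in the `δ`-tube about the residual orbit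
of the minimising good history `U₀`, and TUBE∘ fires. [cite: Balaban1985UV3, (12)-(13) p.259 and (18)-(22) p.260; Balaban1985Variational, (142) p.299; Balaban1984PropagatorsII, (1.33)] -/
theorem uniformFibreGapOrbit_of_tube_of_close
    (hT : ∀ (L : ℕ), ∃ c₀ : ℝ, 0 < c₀ ∧ c₀ ≤ 1 ∧ ∀ (cw : ℝ), 0 < cw → cw ≤ c₀ → ∃ pS : ℝ, ∀ (b₀ p₀ : ℝ), 0 < b₀ → pS ≤ p₀ → 0 < p₀ →
      ∃ ε₁ : ℝ, 0 < ε₁ ∧ ∀ (ε₀ : ℝ), 0 < ε₀ → ε₀ ≤ ε₁ → ∃ δ : ℝ, 0 < δ ∧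
      ∃ γ₁ : ℝ, 0 < γ₁ ∧ ∃ μ : ℝ, 0 < μ ∧ ∀ (F : T3Family) (γ : ℝ), F.L = L → 0 < γ → γ ≤ γ₁ →
        ∀ (J K : ℕ) (hJK : J ≤ K) (V : GaugeField (F.P J) 0 (Matrix.specialUnitaryGroup (Fin 2) ℂ)), PlaqSmall (θBal F.L γ (cw * b₀) p₀ J) V →
          ∀ U₀ ∈ {U' | U' ∈ fibre F ℰp J K hJK V ∧ U' ∈ histGood F ℰp (θBal F.L γ b₀ p₀) K J ∧
              wilsonAction4 U' = minActionRegPr F J K hJK ε₀ V},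
            ∀ U ∈ fibre F ℰp J K hJK V, U ∈ histGood F ℰp (θBal F.L γ b₀ p₀) K J →
              (∃ w : Site (F.P K) 0 → Matrix.specialUnitaryGroup (Fin 2) ℂ,
                (∀ U'' : GaugeField (F.P K) 0 (Matrix.specialUnitaryGroup (Fin 2) ℂ),
                    descendTo F ℰp J K hJK (GaugeField.gaugeAct w U'') = descendTo F ℰp J K hJK U'') ∧
                  ∀ ℓ : PBond (F.P K) 0, dist1 (U ℓ * ((GaugeField.gaugeAct w U₀) ℓ)⁻¹) ≤ δ) →
              μ * ((F.L : ℝ)⁻¹) ^ (2 * (K - J)) *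
                  (⨅ w : {w : Site (F.P K) 0 → Matrix.specialUnitaryGroup (Fin 2) ℂ |
                      ∀ U : GaugeField (F.P K) 0 (Matrix.specialUnitaryGroup (Fin 2) ℂ),
                        descendTo F ℰp J K hJK (GaugeField.gaugeAct w U) = descendTo F ℰp J K hJK U},
                    ∑ ℓ : PBond (F.P K) 0,
                      dist1 (U ℓ * ((GaugeField.gaugeAct (w : Site (F.P K) 0 → Matrix.specialUnitaryGroup (Fin 2) ℂ) U₀) ℓ)⁻¹) ^ 2)
                ≤ wilsonAction4 U - minActionRegPr F J K hJK ε₀ V)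
    (hC : ∀ (L : ℕ), ∃ c₀ : ℝ, 0 < c₀ ∧ c₀ ≤ 1 ∧ ∀ (cw : ℝ), 0 < cw → cw ≤ c₀ → ∃ pS : ℝ, ∀ (b₀ p₀ : ℝ), 0 < b₀ → pS ≤ p₀ → 0 < p₀ →
      ∃ ε₁ : ℝ, 0 < ε₁ ∧ ∀ (ε₀ : ℝ), 0 < ε₀ → ε₀ ≤ ε₁ → ∀ (δ : ℝ), 0 < δ →
      ∃ γ₁ : ℝ, 0 < γ₁ ∧ ∀ (F : T3Family) (γ : ℝ), F.L = L → 0 < γ → γ ≤ γ₁ →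
        ∀ (J K : ℕ) (hJK : J ≤ K) (V : GaugeField (F.P J) 0 (Matrix.specialUnitaryGroup (Fin 2) ℂ)), PlaqSmall (θBal F.L γ (cw * b₀) p₀ J) V →
          ∀ U₀ ∈ {U' | U' ∈ fibre F ℰp J K hJK V ∧ U' ∈ histGood F ℰp (θBal F.L γ b₀ p₀) K J ∧
              wilsonAction4 U' = minActionRegPr F J K hJK ε₀ V},
            ∀ U ∈ fibre F ℰp J K hJK V, U ∈ histGood F ℰp (θBal F.L γ b₀ p₀) K J →
              ∃ w : Site (F.P K) 0 → Matrix.specialUnitaryGroup (Fin 2) ℂ,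
                (∀ U'' : GaugeField (F.P K) 0 (Matrix.specialUnitaryGroup (Fin 2) ℂ),
                    descendTo F ℰp J K hJK (GaugeField.gaugeAct w U'') = descendTo F ℰp J K hJK U'') ∧
                  ∀ ℓ : PBond (F.P K) 0, dist1 (U ℓ * ((GaugeField.gaugeAct w U₀) ℓ)⁻¹) ≤ δ) :
    ∀ (L : ℕ), ∃ c₀ : ℝ, 0 < c₀ ∧ c₀ ≤ 1 ∧ ∀ (cw : ℝ), 0 < cw → cw ≤ c₀ → ∃ pS : ℝ, ∀ (b₀ p₀ : ℝ), 0 < b₀ → pS ≤ p₀ → 0 < p₀ →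
      ∃ ε₁ : ℝ, 0 < ε₁ ∧ ∀ (ε₀ : ℝ), 0 < ε₀ → ε₀ ≤ ε₁ →
      ∃ γ₁ : ℝ, 0 < γ₁ ∧ ∃ μ : ℝ, 0 < μ ∧ ∀ (F : T3Family) (γ : ℝ), F.L = L → 0 < γ → γ ≤ γ₁ →
        ∀ (J K : ℕ) (hJK : J ≤ K) (V : GaugeField (F.P J) 0 (Matrix.specialUnitaryGroup (Fin 2) ℂ)), PlaqSmall (θBal F.L γ (cw * b₀) p₀ J) V →
          ∀ U₀ ∈ {U' | U' ∈ fibre F ℰp J K hJK V ∧ U' ∈ histGood F ℰp (θBal F.L γ b₀ p₀) K J ∧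
              wilsonAction4 U' = minActionRegPr F J K hJK ε₀ V},
            ∀ U ∈ fibre F ℰp J K hJK V, U ∈ histGood F ℰp (θBal F.L γ b₀ p₀) K J →
              μ * ((F.L : ℝ)⁻¹) ^ (2 * (K - J)) *
                  (⨅ w : {w : Site (F.P K) 0 → Matrix.specialUnitaryGroup (Fin 2) ℂ |
                      ∀ U : GaugeField (F.P K) 0 (Matrix.specialUnitaryGroup (Fin 2) ℂ),
                        descendTo F ℰp J K hJK (GaugeField.gaugeAct w U) = descendTo F ℰp J K hJK U},
                    ∑ ℓ : PBond (F.P K) 0,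
                      dist1 (U ℓ * ((GaugeField.gaugeAct (w : Site (F.P K) 0 → Matrix.specialUnitaryGroup (Fin 2) ℂ) U₀) ℓ)⁻¹) ^ 2)
                ≤ wilsonAction4 U - minActionRegPr F J K hJK ε₀ V := by
  intro L
  obtain ⟨c₁, hc₁, hc₁1, h₁⟩ := hT L
  obtain ⟨c₂, hc₂, -, h₂⟩ := hC L
  refine ⟨min c₁ c₂, lt_min hc₁ hc₂, (min_le_left _ _).trans hc₁1, fun cw hcw0 hcwle => ?_⟩
  obtain ⟨pS₁, h₁'⟩ := h₁ cw hcw0 (hcwle.trans (min_le_left _ _))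
  obtain ⟨pS₂, h₂'⟩ := h₂ cw hcw0 (hcwle.trans (min_le_right _ _))
  refine ⟨max pS₁ pS₂, fun b₀ p₀ hb hpS hp => ?_⟩
  obtain ⟨ε₁, hε₁, h₁''⟩ := h₁' b₀ p₀ hb ((le_max_left _ _).trans hpS) hp
  obtain ⟨ε₂, hε₂, h₂''⟩ := h₂' b₀ p₀ hb ((le_max_right _ _).trans hpS) hp
  refine ⟨min ε₁ ε₂, lt_min hε₁ hε₂, fun ε₀ hε₀ hε₀le => ?_⟩
  obtain ⟨δ, hδ, γ₁, hγ₁, μ, hμ, H₁⟩ := h₁'' ε₀ hε₀ (hε₀le.trans (min_le_left _ _))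
  obtain ⟨γ₂, hγ₂, H₂⟩ := h₂'' ε₀ hε₀ (hε₀le.trans (min_le_right _ _)) δ hδ
  refine ⟨min γ₁ γ₂, lt_min hγ₁ hγ₂, μ, hμ, fun F γ hFL hγ hγle J K hJK V hV U₀ hU₀ U hU hUg => ?_⟩
  have htube := H₂ F γ hFL hγ (hγle.trans (min_le_right _ _)) J K hJK V hV U₀ hU₀ U hU hUg
  exact H₁ F γ hFL hγ (hγle.trans (min_le_left _ _)) J K hJK V hV U₀ hU₀ U hU hUg htube

/-- ★★ **TUBE∘ ∧ CLOSE-PAIR∘ ⟹ GAP♯∘** — the same door from the binder-light pair form of the closeness row (§1 ∘ §3).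
[cite: Balaban1985RegularSpaces, Lemma 1 (1.24)-(1.26) pp.79-80; Balaban1985Variational, (142) p.299] -/
theorem uniformFibreGapOrbit_of_tube_of_closePair
    (hT : ∀ (L : ℕ), ∃ c₀ : ℝ, 0 < c₀ ∧ c₀ ≤ 1 ∧ ∀ (cw : ℝ), 0 < cw → cw ≤ c₀ → ∃ pS : ℝ, ∀ (b₀ p₀ : ℝ), 0 < b₀ → pS ≤ p₀ → 0 < p₀ →
      ∃ ε₁ : ℝ, 0 < ε₁ ∧ ∀ (ε₀ : ℝ), 0 < ε₀ → ε₀ ≤ ε₁ → ∃ δ : ℝ, 0 < δ ∧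
      ∃ γ₁ : ℝ, 0 < γ₁ ∧ ∃ μ : ℝ, 0 < μ ∧ ∀ (F : T3Family) (γ : ℝ), F.L = L → 0 < γ → γ ≤ γ₁ →
        ∀ (J K : ℕ) (hJK : J ≤ K) (V : GaugeField (F.P J) 0 (Matrix.specialUnitaryGroup (Fin 2) ℂ)), PlaqSmall (θBal F.L γ (cw * b₀) p₀ J) V →
          ∀ U₀ ∈ {U' | U' ∈ fibre F ℰp J K hJK V ∧ U' ∈ histGood F ℰp (θBal F.L γ b₀ p₀) K J ∧
              wilsonAction4 U' = minActionRegPr F J K hJK ε₀ V},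
            ∀ U ∈ fibre F ℰp J K hJK V, U ∈ histGood F ℰp (θBal F.L γ b₀ p₀) K J →
              (∃ w : Site (F.P K) 0 → Matrix.specialUnitaryGroup (Fin 2) ℂ,
                (∀ U'' : GaugeField (F.P K) 0 (Matrix.specialUnitaryGroup (Fin 2) ℂ),
                    descendTo F ℰp J K hJK (GaugeField.gaugeAct w U'') = descendTo F ℰp J K hJK U'') ∧
                  ∀ ℓ : PBond (F.P K) 0, dist1 (U ℓ * ((GaugeField.gaugeAct w U₀) ℓ)⁻¹) ≤ δ) →
              μ * ((F.L : ℝ)⁻¹) ^ (2 * (K - J)) *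
                  (⨅ w : {w : Site (F.P K) 0 → Matrix.specialUnitaryGroup (Fin 2) ℂ |
                      ∀ U : GaugeField (F.P K) 0 (Matrix.specialUnitaryGroup (Fin 2) ℂ),
                        descendTo F ℰp J K hJK (GaugeField.gaugeAct w U) = descendTo F ℰp J K hJK U},
                    ∑ ℓ : PBond (F.P K) 0,
                      dist1 (U ℓ * ((GaugeField.gaugeAct (w : Site (F.P K) 0 → Matrix.specialUnitaryGroup (Fin 2) ℂ) U₀) ℓ)⁻¹) ^ 2)
                ≤ wilsonAction4 U - minActionRegPr F J K hJK ε₀ V)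
    (hP : ∀ (L : ℕ) (b₀ p₀ : ℝ), 0 < b₀ → 0 < p₀ → ∀ (δ : ℝ), 0 < δ →
      ∃ γ₁ : ℝ, 0 < γ₁ ∧ ∀ (F : T3Family) (γ : ℝ), F.L = L → 0 < γ → γ ≤ γ₁ →
        ∀ (J K : ℕ) (hJK : J ≤ K) (V : GaugeField (F.P J) 0 (Matrix.specialUnitaryGroup (Fin 2) ℂ)),
          ∀ U' ∈ fibre F ℰp J K hJK V, U' ∈ histGood F ℰp (θBal F.L γ b₀ p₀) K J →
            ∀ U ∈ fibre F ℰp J K hJK V, U ∈ histGood F ℰp (θBal F.L γ b₀ p₀) K J →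
              ∃ w : Site (F.P K) 0 → Matrix.specialUnitaryGroup (Fin 2) ℂ,
                (∀ U'' : GaugeField (F.P K) 0 (Matrix.specialUnitaryGroup (Fin 2) ℂ),
                    descendTo F ℰp J K hJK (GaugeField.gaugeAct w U'') = descendTo F ℰp J K hJK U'') ∧
                  ∀ ℓ : PBond (F.P K) 0, dist1 (U ℓ * ((GaugeField.gaugeAct w U') ℓ)⁻¹) ≤ δ) :
    ∀ (L : ℕ), ∃ c₀ : ℝ, 0 < c₀ ∧ c₀ ≤ 1 ∧ ∀ (cw : ℝ), 0 < cw → cw ≤ c₀ → ∃ pS : ℝ, ∀ (b₀ p₀ : ℝ), 0 < b₀ → pS ≤ p₀ → 0 < p₀ →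
      ∃ ε₁ : ℝ, 0 < ε₁ ∧ ∀ (ε₀ : ℝ), 0 < ε₀ → ε₀ ≤ ε₁ →
      ∃ γ₁ : ℝ, 0 < γ₁ ∧ ∃ μ : ℝ, 0 < μ ∧ ∀ (F : T3Family) (γ : ℝ), F.L = L → 0 < γ → γ ≤ γ₁ →
        ∀ (J K : ℕ) (hJK : J ≤ K) (V : GaugeField (F.P J) 0 (Matrix.specialUnitaryGroup (Fin 2) ℂ)), PlaqSmall (θBal F.L γ (cw * b₀) p₀ J) V →
          ∀ U₀ ∈ {U' | U' ∈ fibre F ℰp J K hJK V ∧ U' ∈ histGood F ℰp (θBal F.L γ b₀ p₀) K J ∧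
              wilsonAction4 U' = minActionRegPr F J K hJK ε₀ V},
            ∀ U ∈ fibre F ℰp J K hJK V, U ∈ histGood F ℰp (θBal F.L γ b₀ p₀) K J →
              μ * ((F.L : ℝ)⁻¹) ^ (2 * (K - J)) *
                  (⨅ w : {w : Site (F.P K) 0 → Matrix.specialUnitaryGroup (Fin 2) ℂ |
                      ∀ U : GaugeField (F.P K) 0 (Matrix.specialUnitaryGroup (Fin 2) ℂ),
                        descendTo F ℰp J K hJK (GaugeField.gaugeAct w U) = descendTo F ℰp J K hJK U},
                    ∑ ℓ : PBond (F.P K) 0,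
                      dist1 (U ℓ * ((GaugeField.gaugeAct (w : Site (F.P K) 0 → Matrix.specialUnitaryGroup (Fin 2) ℂ) U₀) ℓ)⁻¹) ^ 2)
                ≤ wilsonAction4 U - minActionRegPr F J K hJK ε₀ V :=
  uniformFibreGapOrbit_of_tube_of_close hT (close_of_closePair hP)

end Summit.QuantumFields.YangMills.Theorems.FluctuationComparisonRegPrIntLS2BetaGapOrbitOfTubeClose

end
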